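import Mathlib
import Literature.RingTheory.Derivation.HochschildFormula
import Literature.RingTheory.Derivation.MonogenicBasis
import HarnessLib

/-!
# `p`-closed derivations: nilpotent normalisation and the Taylor decomposition

Topic: `Literature/RingTheory/Derivation`. Let `K` be a field of prime characteristic `p` and
`D` an `R`-derivation of `K` which is **`p`-closed**, `D^[p] = c · D` for some `c ∈ K`, and let
`t ∈ K` with `D t ≠ 0`. Following Rudakov–Shafarevich [RudakovShafarevich1976, §1] (and
Jacobson's Galois theory of purely inseparable extensions of exponent one):

* (a) `iterate_inv_smul_eq_zero`: the normalised derivation `δ := (D t)⁻¹ • D` has `δ t = 1`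
  and is **nilpotent of order `p`**: `δ^[p] = 0`. (Hochschild's formula
  `D^[p] = (D t)^p δ^[p] + (D^[p-1] (D t)) δ` for `D = (D t) • δ`, and
  `D^[p-1] (D t) = D^[p] t = c D t`.)
* (b) `apply_taylorSum_eq_zero`: for a derivation `δ` with `δ t = 1` and `δ^[p] x = 0` the
  **Taylor projection** `π x := ∑_{i<p} ((-t)^i / i!) δ^[i] x` is a `δ`-constant (telescoping).
* (c) `eq_sum_pow_mul_taylorSum`: `x = ∑_{j<p} (t^j / j!) · π (δ^[j] x)` (the binomial
  cancellation `∑_{i+j=n} (-t)^i t^j / (i! j!) = (t - t)^n / n! = [n = 0]` for `n < p`).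
* (d) `eq_zero_of_sum_mul_pow_eq_zero`: **uniqueness** — a relation `∑_{i<m} aᵢ tⁱ = 0`,
  `m ≤ p`, with `δ`-constant coefficients is trivial (apply `δ^[m-1]` and induct, using
  `derivation_iterate_pow_self` / `_of_lt` from `MonogenicBasis`).
* (e) For the `p`-closed `D`: `exists_sum_pow_of_iterate_eq_mul` (every `x ∈ K` is
  `∑_{i<p} aᵢ tⁱ` with `D aᵢ = 0`), `eq_zero_of_sum_fin_eq_zero` (uniqueness), and
  `finrank_eq_of_iterate_eq_mul` / `exists_subfield_finrank_eq`: `[K : K^D] = p` for the field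
  of constants `K^D` (stated for any `L : Subfield K` with `y ∈ L ↔ D y = 0`, whose existence
  is `exists_subfield_forall_mem_iff`, to stay definition-free).

Everything is stated by explicit formulas (no new definitions). Division by `i!` is harmless as
only `i < p` occurs (`cast_factorial_ne_zero`).

References: A. N. Rudakov, I. R. Shafarevich, *Inseparable morphisms of algebraic surfaces*,
Izv. Akad. Nauk SSSR 40 (1976), §1 (opening paragraph and Thm. 1: `K/K^D` has degree `p`,
`D ∼ ∂/∂t`); N. Jacobson, *Lectures in Abstract Algebra III*, Ch. IV §8; G. Hochschild,
Trans. AMS 79 (1955), Lemma 1 (via `Literature.RingTheory.Derivation.HochschildFormula`).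
No named facts.
-/

noncomputable section

open Finset Module
open scoped Nat

namespace Literature.RingTheory.Derivation

namespace PClosed

variable {R K : Type*} [CommRing R] [Field K] [Algebra R K] {p : ℕ}

/-! ### Factorials below `p` are units -/

/-- In characteristic `p`, `n! ≠ 0` for `n < p`. [folklore] -/
theorem cast_factorial_ne_zero (hp : p.Prime) [CharP K p] {n : ℕ} (hn : n < p) :
    (n ! : K) ≠ 0 := by
  rw [Ne, CharP.cast_eq_zero_iff K p, hp.dvd_factorial, not_le]
  exact hn

/-! ### (a) Normalisation of a `p`-closed derivation is nilpotent -/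

/-- The normalised derivation `(D t)⁻¹ • D` takes the value `1` at `t`. [folklore] -/
theorem inv_smul_apply_self (D : _root_.Derivation R K K) {t : K} (ht : D t ≠ 0) :
    ((D t)⁻¹ • D) t = 1 := by
  rw [Derivation.smul_apply, smul_eq_mul, inv_mul_cancel₀ ht]

/-- The normalised derivation has the same constants: `((D t)⁻¹ • D) y = 0 ↔ D y = 0`.
[folklore] -/
theorem inv_smul_apply_eq_zero_iff (D : _root_.Derivation R K K) {t : K} (ht : D t ≠ 0) (y : K) :
    ((D t)⁻¹ • D) y = 0 ↔ D y = 0 := by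
  rw [Derivation.smul_apply, smul_eq_mul, mul_eq_zero, inv_eq_zero, or_iff_right ht]

/-- **Nilpotency of the normalisation** (Rudakov–Shafarevich). If `D` is a `p`-closed
derivation of a field of characteristic `p`, `D^[p] = c · D`, and `D t ≠ 0`, then
`δ := (D t)⁻¹ • D` satisfies `δ^[p] = 0`: by Hochschild's formula for `D = (D t) • δ`,
`D^[p] x = (D t)^p δ^[p] x + D^[p-1] (D t) · δ x`, and `D^[p-1] (D t) = D^[p] t = c · D t`,
`D^[p] x = c D x = c D t · δ x`, whence `(D t)^p δ^[p] x = 0`.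
[cite: RudakovShafarevich1976, §1] -/
theorem iterate_inv_smul_eq_zero (hp : p.Prime) [CharP K p] (D : _root_.Derivation R K K)
    {c : K} (hD : ∀ x, (⇑D)^[p] x = c * D x) {t : K} (ht : D t ≠ 0) (x : K) :
    (⇑((D t)⁻¹ • D))^[p] x = 0 := by
  set δ := (D t)⁻¹ • D with hδdef
  have hδ : ∀ y, δ y = (D t)⁻¹ * D y := fun y => by rw [hδdef, Derivation.smul_apply, smul_eq_mul]
  have hDδ : ∀ y, D y = D t * δ y := fun y => by rw [hδ, mul_inv_cancel_left₀ ht]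
  have key : D t • δ = D := by
    ext y
    rw [Derivation.smul_apply, smul_eq_mul, ← hDδ]
  have H := δ.hochschild_iterate_smul hp (D t) x
  rw [key] at H
  have h2 : (⇑D)^[p] t = (⇑D)^[p - 1] (D t) := by
    rw [← Function.iterate_succ_apply, Nat.succ_eq_add_one, Nat.sub_add_cancel hp.one_le]
  rw [hD, ← h2, hD, hDδ x] at H
  have h3 : D t ^ p * (⇑δ)^[p] x = 0 := by linear_combination -H
  exact (mul_eq_zero.1 h3).resolve_left (pow_ne_zero _ ht)

/-! ### (b) The Taylor projection of a nilpotent derivation with `δ t = 1` -/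

/-- `δ ((-t)^(i+1) / (i+1)!) = -((-t)^i / i!)` when `δ t = 1` and `i + 1 < p`. [folklore] -/
theorem apply_neg_pow_div_factorial (hp : p.Prime) [CharP K p] (δ : _root_.Derivation R K K)
    {t : K} (ht : δ t = 1) {i : ℕ} (hi : i + 1 < p) :
    δ ((-t) ^ (i + 1) / ((i + 1)! : K)) = -((-t) ^ i / (i ! : K)) := by
  have h1 : ((i + 1 : ℕ) : K) ≠ 0 := by
    rw [Ne, CharP.cast_eq_zero_iff K p]
    exact Nat.not_dvd_of_pos_of_lt (Nat.succ_pos i) hi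
  have h2 : (i ! : K) ≠ 0 := cast_factorial_ne_zero hp (by omega)
  rw [δ.leibniz_div_const _ _ (δ.map_natCast _), δ.leibniz_pow, map_neg, ht, Nat.add_sub_cancel,
    Nat.factorial_succ, Nat.cast_mul, smul_eq_mul, smul_eq_mul, nsmul_eq_mul, mul_inv,
    mul_neg_one]
  field_simp

/-- **The Taylor projection is a constant** (Rudakov–Shafarevich / Jacobson). For a derivation
`δ` of a field of characteristic `p` with `δ t = 1` and `δ^[p] x = 0`:
`δ (∑_{i<p} ((-t)^i / i!) · δ^[i] x) = 0` (the sum telescopes to `((-t)^(p-1)/(p-1)!) δ^[p] x`).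
[cite: RudakovShafarevich1976, §1] -/
theorem apply_taylorSum_eq_zero (hp : p.Prime) [CharP K p] (δ : _root_.Derivation R K K)
    {t : K} (ht : δ t = 1) {x : K} (hx : (⇑δ)^[p] x = 0) :
    δ (∑ i ∈ range p, ((-t) ^ i / (i ! : K)) * (⇑δ)^[i] x) = 0 := by
  obtain ⟨m, hm⟩ : ∃ m, p = m + 1 := ⟨p - 1, (Nat.sub_add_cancel hp.one_le).symm⟩
  have hsplit : ∀ i ∈ range p, δ ((-t) ^ i / (i ! : K) * (⇑δ)^[i] x) =
      (-t) ^ i / (i ! : K) * (⇑δ)^[i + 1] x + (⇑δ)^[i] x * δ ((-t) ^ i / (i ! : K)) := by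
    intro i _
    rw [Derivation.leibniz, smul_eq_mul, smul_eq_mul, Function.iterate_succ_apply']
  rw [map_sum, sum_congr rfl hsplit, sum_add_distrib, hm, sum_range_succ, sum_range_succ', ← hm,
    hx, mul_zero, add_zero, pow_zero, Nat.factorial_zero, Nat.cast_one, div_one,
    Derivation.map_one_eq_zero, mul_zero, add_zero, ← sum_add_distrib]
  refine sum_eq_zero fun i hi => ?_
  rw [apply_neg_pow_div_factorial hp δ ht (by have := mem_range.1 hi; omega)]
  ring

/-! ### (c) The Taylor decomposition -/

/-- **Binomial cancellation.** For `N < p`: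
`∑_{k ≤ N} (t^k / k!) ((-t)^(N-k) / (N-k)!) · y = [N = 0] · y`, since the coefficient is
`(t - t)^N / N!`. [folklore] -/
theorem sum_pow_div_mul_neg_pow_div (hp : p.Prime) [CharP K p] (t y : K) {N : ℕ} (hN : N < p) :
    ∑ k ∈ range (N + 1), t ^ k / (k ! : K) * ((-t) ^ (N - k) / ((N - k)! : K)) * y =
      if N = 0 then y else 0 := by
  have h3 : (N ! : K) ≠ 0 := cast_factorial_ne_zero hp hN
  calc ∑ k ∈ range (N + 1), t ^ k / (k ! : K) * ((-t) ^ (N - k) / ((N - k)! : K)) * y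
      = (∑ k ∈ range (N + 1), t ^ k * (-t) ^ (N - k) * (N.choose k : K)) / (N ! : K) * y := by
        rw [sum_div, sum_mul]
        refine sum_congr rfl fun k hk => ?_
        have hkN : k ≤ N := Nat.lt_succ_iff.1 (mem_range.1 hk)
        have h1 : (k ! : K) ≠ 0 := cast_factorial_ne_zero hp (by omega)
        have h2 : ((N - k)! : K) ≠ 0 := cast_factorial_ne_zero hp (by omega)
        have hchoose : (N ! : K) = (N.choose k : K) * (k ! : K) * ((N - k)! : K) := by
          norm_cast
          rw [Nat.choose_mul_factorial_mul_factorial hkN]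
        congr 1
        rw [eq_div_iff h3, hchoose]
        field_simp
    _ = if N = 0 then y else 0 := by
        rw [← add_pow, add_neg_cancel]
        split_ifs with h
        · subst h
          simp
        · rw [zero_pow h, zero_div, zero_mul]

/-- **Taylor decomposition** (Rudakov–Shafarevich / Jacobson). For a derivation `δ` of a field
of characteristic `p` and `x` with `δ^[p] x = 0`, for every `t`:
`x = ∑_{j<p} (t^j / j!) · π (δ^[j] x)` where `π y = ∑_{i<p} ((-t)^i / i!) δ^[i] y` is the
Taylor projection: the coefficient of `δ^[n] x` is `∑_{i+j=n} (-t)^i t^j / (i! j!) = [n = 0]`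
for `n < p`, and `δ^[n] x = 0` for `n ≥ p`. [cite: RudakovShafarevich1976, §1] -/
theorem eq_sum_pow_mul_taylorSum (hp : p.Prime) [CharP K p] (δ : _root_.Derivation R K K)
    (t : K) {x : K} (hx : (⇑δ)^[p] x = 0) :
    x = ∑ j ∈ range p, (t ^ j / (j ! : K)) *
      ∑ i ∈ range p, ((-t) ^ i / (i ! : K)) * (⇑δ)^[i] ((⇑δ)^[j] x) := by
  have hvan : ∀ n, p ≤ n → (⇑δ)^[n] x = 0 := fun n hn => by
    obtain ⟨k, rfl⟩ := Nat.exists_eq_add_of_le hn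
    rw [add_comm, Function.iterate_add_apply, hx, iterate_map_zero]
  have step1 : ∑ j ∈ range p, (t ^ j / (j ! : K)) *
        ∑ i ∈ range p, ((-t) ^ i / (i ! : K)) * (⇑δ)^[i] ((⇑δ)^[j] x) =
      ∑ j ∈ range p, ∑ i ∈ range (p - j),
        t ^ j / (j ! : K) * ((-t) ^ i / (i ! : K)) * (⇑δ)^[i + j] x := by
    refine sum_congr rfl fun j _ => ?_
    rw [mul_sum, ← sum_range_add_sum_Ico _ (Nat.sub_le p j), sum_eq_zero (s := Ico (p - j) p),
      add_zero]
    · refine sum_congr rfl fun i _ => ?_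
      rw [← Function.iterate_add_apply, mul_assoc]
    · intro i hi
      rw [← Function.iterate_add_apply, hvan _ (by have := (mem_Ico.1 hi).1; omega), mul_zero,
        mul_zero]
  rw [step1, ← sum_range_diag_flip p fun j i =>
    t ^ j / (j ! : K) * ((-t) ^ i / (i ! : K)) * (⇑δ)^[i + j] x]
  have inner : ∀ N ∈ range p, ∑ k ∈ range (N + 1),
      t ^ k / (k ! : K) * ((-t) ^ (N - k) / ((N - k)! : K)) * (⇑δ)^[N - k + k] x =
        if N = 0 then x else 0 := by
    intro N hN
    calc ∑ k ∈ range (N + 1),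
          t ^ k / (k ! : K) * ((-t) ^ (N - k) / ((N - k)! : K)) * (⇑δ)^[N - k + k] x
        = ∑ k ∈ range (N + 1),
            t ^ k / (k ! : K) * ((-t) ^ (N - k) / ((N - k)! : K)) * (⇑δ)^[N] x :=
          sum_congr rfl fun k hk => by
            rw [Nat.sub_add_cancel (Nat.lt_succ_iff.1 (mem_range.1 hk))]
      _ = if N = 0 then (⇑δ)^[N] x else 0 := sum_pow_div_mul_neg_pow_div hp t _ (mem_range.1 hN)
      _ = if N = 0 then x else 0 := by
          split_ifs with h
          · rw [h, Function.iterate_zero_apply]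
          · rfl
  simp_rw [sum_congr rfl inner, sum_ite_eq', mem_range, if_pos hp.pos]

/-! ### (d) Uniqueness of the coefficients -/

/-- Iterates of a derivation commute with multiplication by a constant. [folklore] -/
theorem iterate_apply_const_mul {S : Type*} [CommRing S] [Algebra R S]
    (δ : _root_.Derivation R S S) {a : S} (ha : δ a = 0) (n : ℕ) (y : S) :
    (⇑δ)^[n] (a * y) = a * (⇑δ)^[n] y := by
  induction n with
  | zero => rfl
  | succ n ih =>
    rw [Function.iterate_succ_apply', ih, Derivation.leibniz, smul_eq_mul, smul_eq_mul, ha,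
      mul_zero, add_zero, Function.iterate_succ_apply']

/-- **Uniqueness.** If `δ t = 1` in a field of characteristic `p`, `m ≤ p`, and
`∑_{i<m} aᵢ tⁱ = 0` with `δ aᵢ = 0` for `i < m`, then all `aᵢ = 0` (apply `δ^[m-1]`, which
kills `tⁱ` for `i < m - 1` and sends `t^(m-1)` to the unit `(m-1)!`, and induct).
[cite: RudakovShafarevich1976, §1] -/
theorem eq_zero_of_sum_mul_pow_eq_zero (hp : p.Prime) [CharP K p] (δ : _root_.Derivation R K K)
    {t : K} (ht : δ t = 1) :
    ∀ m, m ≤ p → ∀ a : ℕ → K, (∀ i, i < m → δ (a i) = 0) →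
      ∑ i ∈ range m, a i * t ^ i = 0 → ∀ i, i < m → a i = 0 := by
  intro m
  induction m with
  | zero => intro _ _ _ _ i hi; omega
  | succ m ih =>
    intro hm a ha hsum i hi
    have htop : a m = 0 := by
      have h1 := congr_arg (⇑δ)^[m] hsum
      rw [iterate_map_zero, derivation_iterate_eq_pow_apply, map_sum, sum_range_succ,
        sum_eq_zero, zero_add, ← derivation_iterate_eq_pow_apply,
        iterate_apply_const_mul δ (ha m (lt_add_one m)), derivation_iterate_pow_self δ ht,
        mul_eq_zero] at h1
      · exact h1.resolve_right (cast_factorial_ne_zero hp (by omega))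
      · intro j hj
        have hjm : j < m := mem_range.1 hj
        rw [← derivation_iterate_eq_pow_apply, iterate_apply_const_mul δ (ha j (by omega)),
          derivation_iterate_pow_of_lt δ ht hjm, mul_zero]
    rcases Nat.lt_succ_iff_lt_or_eq.1 hi with hi' | rfl
    · refine ih (by omega) a (fun j hj => ha j (by omega)) ?_ i hi'
      rw [sum_range_succ, htop, zero_mul, add_zero] at hsum
      exact hsum
    · exact htop

/-! ### (e) Consequences for a `p`-closed derivation `D` with `D t ≠ 0` -/

/-- **Taylor projection for a `p`-closed derivation.** With `δ := (D t)⁻¹ • D`: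
`D (∑_{i<p} ((-t)^i / i!) δ^[i] x) = 0` for every `x`. [cite: RudakovShafarevich1976, §1] -/
theorem apply_taylorSum_inv_smul_eq_zero (hp : p.Prime) [CharP K p] (D : _root_.Derivation R K K)
    {c : K} (hD : ∀ x, (⇑D)^[p] x = c * D x) {t : K} (ht : D t ≠ 0) (x : K) :
    D (∑ i ∈ range p, ((-t) ^ i / (i ! : K)) * (⇑((D t)⁻¹ • D))^[i] x) = 0 := by
  have h := apply_taylorSum_eq_zero hp ((D t)⁻¹ • D) (inv_smul_apply_self D ht)
    (iterate_inv_smul_eq_zero hp D hD ht x)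
  rwa [inv_smul_apply_eq_zero_iff D ht] at h

/-- **Taylor decomposition for a `p`-closed derivation.** With `δ := (D t)⁻¹ • D` and
`π y := ∑_{i<p} ((-t)^i / i!) δ^[i] y`: `x = ∑_{j<p} (t^j / j!) · π (δ^[j] x)` for every `x`.
[cite: RudakovShafarevich1976, §1] -/
theorem eq_sum_pow_mul_taylorSum_inv_smul (hp : p.Prime) [CharP K p]
    (D : _root_.Derivation R K K) {c : K} (hD : ∀ x, (⇑D)^[p] x = c * D x) {t : K}
    (ht : D t ≠ 0) (x : K) :
    x = ∑ j ∈ range p, (t ^ j / (j ! : K)) *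
      ∑ i ∈ range p, ((-t) ^ i / (i ! : K)) * (⇑((D t)⁻¹ • D))^[i] ((⇑((D t)⁻¹ • D))^[j] x) :=
  eq_sum_pow_mul_taylorSum hp ((D t)⁻¹ • D) t (iterate_inv_smul_eq_zero hp D hD ht x)

/-- **`K = ⊕_{i<p} K^D · tⁱ`, existence.** If `D` is a `p`-closed derivation (`D^[p] = c · D`)
of a field `K` of characteristic `p` and `D t ≠ 0`, then every `x ∈ K` is
`∑_{i<p} aᵢ tⁱ` with `D aᵢ = 0` (namely `aᵢ = π (δ^[i] x) / i!`).
[cite: RudakovShafarevich1976, §1] -/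
theorem exists_sum_pow_of_iterate_eq_mul (hp : p.Prime) [CharP K p]
    (D : _root_.Derivation R K K) {c : K} (hD : ∀ x, (⇑D)^[p] x = c * D x) {t : K}
    (ht : D t ≠ 0) (x : K) :
    ∃ a : Fin p → K, (∀ i, D (a i) = 0) ∧ x = ∑ i, a i * t ^ (i : ℕ) := by
  refine ⟨fun i => ((i : ℕ)! : K)⁻¹ * ∑ k ∈ range p,
      ((-t) ^ k / (k ! : K)) * (⇑((D t)⁻¹ • D))^[k] ((⇑((D t)⁻¹ • D))^[(i : ℕ)] x),
    fun i => ?_, ?_⟩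
  · rw [Derivation.leibniz, apply_taylorSum_inv_smul_eq_zero hp D hD ht, smul_zero, zero_add,
      Derivation.leibniz_inv, Derivation.map_natCast, smul_zero, smul_zero]
  · rw [Fin.sum_univ_eq_sum_range (fun i => ((i ! : K))⁻¹ * (∑ k ∈ range p,
      ((-t) ^ k / (k ! : K)) * (⇑((D t)⁻¹ • D))^[k] ((⇑((D t)⁻¹ • D))^[i] x)) * t ^ i) p]
    refine (eq_sum_pow_mul_taylorSum_inv_smul hp D hD ht x).trans (sum_congr rfl fun j _ => ?_)
    ring

/-- **`K = ⊕_{i<p} K^D · tⁱ`, uniqueness.** If `D t ≠ 0` in a field of characteristic `p`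
and `∑_{i<p} aᵢ tⁱ = 0` with `D aᵢ = 0`, then all `aᵢ = 0`. [cite: RudakovShafarevich1976, §1] -/
theorem eq_zero_of_sum_fin_eq_zero (hp : p.Prime) [CharP K p] (D : _root_.Derivation R K K)
    {t : K} (ht : D t ≠ 0) (a : Fin p → K) (ha : ∀ i, D (a i) = 0)
    (h : ∑ i, a i * t ^ (i : ℕ) = 0) (i : Fin p) : a i = 0 := by
  classical
  let a' : ℕ → K := fun j => if h : j < p then a ⟨j, h⟩ else 0
  have ha' : ∀ j, j < p → ((D t)⁻¹ • D) (a' j) = 0 := fun j hj => by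
    simp only [a', dif_pos hj]
    rw [inv_smul_apply_eq_zero_iff D ht]
    exact ha _
  have hsum : ∑ j ∈ range p, a' j * t ^ j = 0 := by
    rw [← Fin.sum_univ_eq_sum_range (fun j => a' j * t ^ j) p, ← h]
    refine sum_congr rfl fun j _ => ?_
    simp only [a', dif_pos j.2, Fin.eta]
  have key := eq_zero_of_sum_mul_pow_eq_zero hp ((D t)⁻¹ • D) (inv_smul_apply_self D ht) p le_rfl
    a' ha' hsum i i.2
  simpa only [a', dif_pos i.2, Fin.eta] using key

/-- The constants `{y | D y = 0}` of a derivation of a field form a subfield (closed under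
inverses by `D y⁻¹ = -y⁻² · D y`); existence form, to stay definition-free. [folklore] -/
theorem exists_subfield_forall_mem_iff (D : _root_.Derivation R K K) :
    ∃ L : Subfield K, ∀ y, y ∈ L ↔ D y = 0 := by
  refine ⟨{ carrier := {y | D y = 0}
            mul_mem' := fun {a b} ha hb => ?_
            one_mem' := D.map_one_eq_zero
            add_mem' := fun {a b} ha hb => ?_
            zero_mem' := map_zero D
            neg_mem' := fun {a} ha => ?_
            inv_mem' := fun a ha => ?_ }, fun y => Iff.rfl⟩
  · simp only [Set.mem_setOf_eq] at ha hb ⊢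
    rw [Derivation.leibniz, ha, hb, smul_zero, smul_zero, add_zero]
  · simp only [Set.mem_setOf_eq] at ha hb ⊢
    rw [map_add, ha, hb, add_zero]
  · simp only [Set.mem_setOf_eq] at ha ⊢
    rw [map_neg, ha, neg_zero]
  · simp only [Set.mem_setOf_eq] at ha ⊢
    rw [Derivation.leibniz_inv, ha, smul_zero]

/-- **Degree of the field of constants of a `p`-closed derivation** (Rudakov–Shafarevich, §1:
"any `p`-closed derivation defines a subfield `L = K^D` over which `K` is an inseparable
extension of degree `p`"). If `D^[p] = c · D`, `D t ≠ 0`, and `L` is the subfield of constants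
of `D`, then `[K : L] = p` (`1, t, …, t^(p-1)` is an `L`-basis).
[cite: RudakovShafarevich1976, §1] -/
theorem finrank_eq_of_iterate_eq_mul (hp : p.Prime) [CharP K p] (D : _root_.Derivation R K K)
    {c : K} (hD : ∀ x, (⇑D)^[p] x = c * D x) {t : K} (ht : D t ≠ 0) (L : Subfield K)
    (hL : ∀ y, y ∈ L ↔ D y = 0) : Module.finrank L K = p := by
  classical
  have hli : LinearIndependent L (fun i : Fin p => t ^ (i : ℕ)) := by
    rw [Fintype.linearIndependent_iff]
    intro g hg i
    have key := eq_zero_of_sum_fin_eq_zero hp D ht (fun i => (g i : K))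
      (fun i => (hL _).1 (g i).2) hg i
    exact Subtype.ext key
  have hsp : ⊤ ≤ Submodule.span L (Set.range fun i : Fin p => t ^ (i : ℕ)) := by
    rintro x -
    obtain ⟨a, ha, hx⟩ := exists_sum_pow_of_iterate_eq_mul hp D hD ht x
    rw [hx]
    refine Submodule.sum_mem _ fun i _ => ?_
    have e : a i * t ^ (i : ℕ) = (⟨a i, (hL _).2 (ha i)⟩ : L) • t ^ (i : ℕ) := rfl
    rw [e]
    exact Submodule.smul_mem _ _ (Submodule.subset_span ⟨i, rfl⟩)
  rw [finrank_eq_card_basis (Basis.mk hli hsp), Fintype.card_fin]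

/-- **The field of constants of a `p`-closed derivation has codegree `p`**: if
`D^[p] = c · D` on a field `K` of characteristic `p` and `D ≠ 0` (say `D t ≠ 0`), then the
subfield `K^D = {y | D y = 0}` exists with `[K : K^D] = p` (Rudakov–Shafarevich, §1).
[cite: RudakovShafarevich1976, §1] -/
theorem exists_subfield_finrank_eq (hp : p.Prime) [CharP K p] (D : _root_.Derivation R K K)
    {c : K} (hD : ∀ x, (⇑D)^[p] x = c * D x) {t : K} (ht : D t ≠ 0) :
    ∃ L : Subfield K, (∀ y, y ∈ L ↔ D y = 0) ∧ Module.finrank L K = p := by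
  obtain ⟨L, hL⟩ := exists_subfield_forall_mem_iff D
  exact ⟨L, hL, finrank_eq_of_iterate_eq_mul hp D hD ht L hL⟩

end PClosed

end Literature.RingTheory.Derivation

end
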